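import Summits.HodgeConjecture.HodgeConjecture.Theorems.Ring2HypothesesDescentMotivatedExteriorSumSl2Relation
import Literature.AlgebraicGeometry.HodgeTheory.MotivatedClassesAlgebraic
import Literature.AlgebraicGeometry.HodgeTheory.GysinFormalismCorrespondences
import Literature.AlgebraicGeometry.HodgeTheory.ComplexConjugation
import HarnessLib

/-!
# Ring 2 hypotheses, descent face — HARD LEFSCHETZ FOR THE EXTERIOR SUM `η₁ ⊠ 1 + 1 ⊠ η₂` on the real
# carriers: the product of two polarised varieties is polarised by the exterior sum

research route conditional on HC_CM; not a corollary; Q11.4-sentence-2 already refuted in dim ≥ 3.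
Cell `pub-hodge-ring2` (Hodge ladder STAGE 3), seat `ring2-b05` (binder row b05), gen 34. `HC_CM` does not
occur in this file; nothing here proves a case of the Hodge conjecture.

Step 3b of the port of the elementary `𝔰𝔩₂` argument (Kleiman 1968 Thm. 2.9; André 1996 §1.3; the tree's
abstract `Motives/StandardConjecturesKunnethSl2Proofs.prod_lefschetzPow_bijective`) to singular cohomology.
For `X₁`, `X₂` smooth projective complex varieties of dimensions `n₁`, `n₂` and classes `η₁`, `η₂` with the
hard Lefschetz property in dimensions `n₁`, `n₂`, the exterior sum `θ = fst^* η₁ + snd^* η₂ ∈ H²((X₁ ⊗ X₂)(ℂ); ℂ)`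
has the hard Lefschetz property in dimension `n₁ + n₂`; in particular **the exterior sum of two
polarisation classes is a polarisation class** (`IsPolarizationClass`, André 1996 §1.1) — the input of
André's Prop. 2.1 (ii), first inclusion, that the real carriers lacked
(`Theorems/HeckePrymWeilSummitOffWeilSectorMotivatedPullbackFstBelowMiddle`, module docstring; on the
abstract side it is the AXIOM `PreWeilCohomology.HasProdHyperplaneClasses` of `Motives/MotivatedCycles`).

* (§1, file `…ExteriorSumSl2Relation`) the `𝔰𝔩₂` relation `[L_θ, Λ₁₂] = deg - n₁ - n₂` on
  `H•((X₁ ⊗ X₂)(ℂ))` for `Λ₁₂ = Λ₁ ⊗ 1 + 1 ⊗ Λ₂`;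
* §2 `sl2_lefschetzPow_lowering_sub`, `sl2_lowering_lefschetzPow_of_le_one` — the commutator identities
  `[Lˢ⁺¹, Λ] = (s + 1)(d - N + s) Lˢ` for ANY class `θ` on a space with an operator `Λ` satisfying the relation;
* §3 `sl2_lefschetzPow_injective` — **`Lʷ : Hᵈ → H^{d+2w}` is injective for `d + w = N`** (strong induction on
  `d`: `Λ v` is killed by `Lʷ⁺²`, hence vanishes; then the lowest-weight string through `v` forces `v = 0`,
  `char ℂ = 0`);
* §4 `hasHardLefschetzProperty_boxSum` — **hard Lefschetz for `θ` in dimension `n₁ + n₂`** (injectivity and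
  the Poincaré-duality dimension count `finrank_singularCohomology_eq_of_add_eq` on `X₁ ⊗ X₂`), and
  `isPolarizationClass_boxSum` — `θ` is a polarisation class of `X₁ ⊗ X₂` when `η₁`, `η₂` are.

No definition, no named fact, no sorry.

References: Kleiman1968AlgebraicCycles (§1.4 (1.4.6), Thm. 2.9), Andre1996Motifs (§1.1 p. 10, §1.3 pp. 12–13),
VoisinHodgeI2002 (§6.2.3 Thm. 6.25), HatcherAT2002 (§3.2 Thm. 3.16, §3.3 Cor. 3.37).
-/

noncomputable section

-- every declaration of this problem lives in `Summit.HodgeConjecture.HodgeConjecture.…` (summit = sub-problem)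
set_option linter.dupNamespace false

open CategoryTheory AlgebraicGeometry MonoidalCategory CartesianMonoidalCategory
open Literature.AlgebraicTopology.SingularHomology Literature.Geometry.Kaehler
open Literature.AlgebraicGeometry Literature.AlgebraicGeometry.Motives
  Literature.AlgebraicGeometry.HodgeTheory

namespace Summit.HodgeConjecture.HodgeConjecture.Theorems

variable {n₁ n₂ : ℕ} {X₁ X₂ : SchemeOver ℂ}

/-! ## §2 Commutators with powers of `L` (any class, any operator with the relation) -/

section Formal

variable {Y : Type} [TopologicalSpace Y] (θ : singularCohomology ℂ ℂ Y 2) (N : ℕ)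
  (Λ : (a b : ℕ) → singularCohomology ℂ ℂ Y a →ₗ[ℂ] singularCohomology ℂ ℂ Y b)
  (hR : ∀ {c d e : ℕ} (hcd : c + 2 * 1 = d) (hde : d + 2 * 1 = e) (y : singularCohomology ℂ ℂ Y d),
    lefschetzPowTo θ 1 c d hcd (Λ d c y) - Λ e d (lefschetzPowTo θ 1 d e hde y) =
      ((((d : ℤ) - N) : ℤ) : ℂ) • y)
  (hR₁ : ∀ {d e : ℕ} (_ : d ≤ 1) (hde : d + 2 * 1 = e) (y : singularCohomology ℂ ℂ Y d),
    Λ e d (lefschetzPowTo θ 1 d e hde y) = ((((N : ℤ) - d) : ℤ) : ℂ) • y)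

/-- `Lˢ (Lʳ w) = Lᵗ w` for `r + s = t` (explicit degrees). [cite: VoisinHodgeI2002, §6.2.3] -/
theorem lefschetzPowTo_comp_apply {r s t i j m : ℕ} (hrs : r + s = t) (h₁ : i + 2 * r = j)
    (h₂ : j + 2 * s = m) (h₃ : i + 2 * t = m) (w : singularCohomology ℂ ℂ Y i) :
    lefschetzPowTo θ s j m h₂ (lefschetzPowTo θ r i j h₁ w) = lefschetzPowTo θ t i m h₃ w := by
  subst hrs
  exact lefschetzPowTo_lefschetzPowTo θ s h₁ h₂ h₃ w

include hR in
/-- **`[Lˢ⁺¹, Λ] = (s + 1)(d - N + s) Lˢ` on `Hᵈ`**, `d ≥ 2` (`c + 2 = d`; the standard `𝔰𝔩₂` identity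
`[eˢ, f] = s eˢ⁻¹ (h + s - 1)`, by induction on `s` from the relation `[L, Λ] = deg - N`). Degrees:
`c + 2(s+1) = cs`, `d + 2(s+1) = ds`, `d + 2s = cs`. [cite: Kleiman1968AlgebraicCycles, §1.4 (1.4.6)] -/
theorem sl2_lefschetzPow_lowering_sub {c d : ℕ} (hcd : c + 2 = d) (v : singularCohomology ℂ ℂ Y d) (s : ℕ) :
    ∀ {cs ds : ℕ} (hcs : c + 2 * (s + 1) = cs) (hds : d + 2 * (s + 1) = ds) (hd : d + 2 * s = cs),
      lefschetzPowTo θ (s + 1) c cs hcs (Λ d c v) - Λ ds cs (lefschetzPowTo θ (s + 1) d ds hds v) =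
        ((((s : ℤ) + 1) * ((d : ℤ) - N + s) : ℤ) : ℂ) • lefschetzPowTo θ s d cs hd v := by
  induction s with
  | zero =>
    intro cs ds hcs hds hd
    obtain rfl : cs = d := by omega
    rw [lefschetzPowTo_zero_apply, hR hcs hds v]
    congr 1
    push_cast
    ring
  | succ s ih =>
    intro cs ds hcs hds hd
    obtain ⟨cs₀, hcs₀⟩ : ∃ cs₀, c + 2 * (s + 1) = cs₀ := ⟨_, rfl⟩
    have h₁ : cs₀ + 2 * 1 = cs := by omega
    have h₂ : cs + 2 * 1 = ds := by omega
    have ih' := ih hcs₀ hd (show d + 2 * s = cs₀ by omega)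
    rw [sub_eq_iff_eq_add] at ih'
    rw [← lefschetzPowTo_comp_apply θ (show s + 1 + 1 = s + 1 + 1 from rfl) hcs₀ h₁ hcs, ih', map_add,
      map_smul, lefschetzPowTo_comp_apply θ rfl (show d + 2 * s = cs₀ by omega) h₁ hd,
      ← lefschetzPowTo_comp_apply θ (show s + 1 + 1 = s + 1 + 1 from rfl) hd h₂ hds v, add_sub_assoc,
      hR h₁ h₂, ← add_smul]
    subst hd
    congr 1
    push_cast
    ring

include hR hR₁ in
/-- The commutator identity in the lowest degrees `d ≤ 1` (no `Λ v` term):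
`Λ (Lˢ⁺¹ v) = -(s + 1)(d - N + s) Lˢ v`. [cite: Kleiman1968AlgebraicCycles, §1.4 (1.4.6)] -/
theorem sl2_lowering_lefschetzPow_of_le_one {d : ℕ} (hd1 : d ≤ 1) (v : singularCohomology ℂ ℂ Y d) (s : ℕ) :
    ∀ {cs ds : ℕ} (hds : d + 2 * (s + 1) = ds) (hd : d + 2 * s = cs),
      Λ ds cs (lefschetzPowTo θ (s + 1) d ds hds v) =
        ((-(((s : ℤ) + 1) * ((d : ℤ) - N + s)) : ℤ) : ℂ) • lefschetzPowTo θ s d cs hd v := by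
  induction s with
  | zero =>
    intro cs ds hds hd
    obtain rfl : cs = d := by omega
    rw [lefschetzPowTo_zero_apply, hR₁ hd1 hds v]
    congr 1
    push_cast
    ring
  | succ s ih =>
    intro cs ds hds hd
    obtain ⟨cs₀, hcs₀⟩ : ∃ cs₀, d + 2 * s = cs₀ := ⟨_, rfl⟩
    have h₁ : cs₀ + 2 * 1 = cs := by omega
    have h₂ : cs + 2 * 1 = ds := by omega
    have key := hR h₁ h₂ (lefschetzPowTo θ (s + 1) d cs hd v)
    rw [ih hd hcs₀, map_smul, lefschetzPowTo_comp_apply θ rfl hcs₀ h₁ hd] at key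
    have key' := eq_sub_of_add_eq' (sub_eq_iff_eq_add.mp key).symm
    rw [← lefschetzPowTo_comp_apply θ (show s + 1 + 1 = s + 1 + 1 from rfl) hd h₂ hds v, key', ← sub_smul]
    subst hd
    congr 1
    push_cast
    ring

/-! ## §3 Injectivity of `Lʷ : Hᵈ → H^{2N-d}` -/

include hR hR₁ in
/-- **Hard Lefschetz, injectivity half, from the `𝔰𝔩₂` relation**: for `d + w = N`,
`Lʷ : Hᵈ(Y; ℂ) → H^{d+2w}(Y; ℂ)` is injective. Strong induction on `d`: if `Lʷ v = 0` then `Λ v ∈ Hᵈ⁻²`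
is killed by `Lʷ⁺²` (commutator identity), hence vanishes by induction; then `Λ (Lᵗ⁺¹ v) = (t+1)(w-t) Lᵗ v`
forces `Lᵗ v = 0` for `t = w, w-1, …, 0` (`char ℂ = 0`). [cite: Kleiman1968AlgebraicCycles, Thm. 2.9] -/
theorem sl2_lefschetzPow_injective (d : ℕ) :
    ∀ {w e : ℕ} (_ : d + w = N) (he : d + 2 * w = e), Function.Injective (lefschetzPowTo θ w d e he) := by
  induction d using Nat.strong_induction_on with | _ d ih => ?_
  intro w e hw he
  subst he
  rw [injective_iff_map_eq_zero]
  intro v hv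
  -- Step 1: `Λ v = 0`
  have hF : ∀ {c : ℕ} (hcd : c + 2 = d), Λ d c v = 0 := by
    intro c hcd
    have hinj := ih c (by omega) (w := w + 1 + 1) (e := c + 2 * (w + 1 + 1)) (by omega) rfl
    refine (injective_iff_map_eq_zero _).mp hinj _ ?_
    have key := sl2_lefschetzPow_lowering_sub θ N Λ hR hcd v (w + 1)
      (cs := c + 2 * (w + 1 + 1)) (ds := d + 2 * (w + 1 + 1)) rfl rfl (by omega)
    have h2 : lefschetzPowTo θ (w + 1 + 1) d (d + 2 * (w + 1 + 1)) rfl v = 0 := by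
      rw [← lefschetzPowTo_comp_apply θ (show w + (1 + 1) = w + 1 + 1 by omega) rfl
        (show d + 2 * w + 2 * (1 + 1) = d + 2 * (w + 1 + 1) by omega) rfl v, hv, map_zero]
    have h1 : lefschetzPowTo θ (w + 1) d (c + 2 * (w + 1 + 1)) (by omega) v = 0 := by
      rw [← lefschetzPowTo_comp_apply θ (show w + 1 = w + 1 from rfl) rfl
        (show d + 2 * w + 2 * 1 = c + 2 * (w + 1 + 1) by omega) _ v, hv, map_zero]
    rwa [h2, map_zero, sub_zero, h1, smul_zero] at key
  -- Step 2: `Lᵗ v = 0` for `t + m = w`, by induction on `m`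
  have hdesc : ∀ (m t e' : ℕ) (he' : d + 2 * t = e'), t + m = w → lefschetzPowTo θ t d e' he' v = 0 := by
    intro m
    induction m with
    | zero =>
      intro t e' he' htm
      obtain rfl : t = w := by omega
      subst he'
      exact hv
    | succ m ihm =>
      intro t e' he' htm
      have hup := ihm (t + 1) (d + 2 * (t + 1)) rfl (by omega)
      have hcoef : ((((t : ℤ) + 1) * ((d : ℤ) - N + t)) : ℤ) ≠ 0 := by
        apply mul_ne_zero <;> omega
      by_cases hd2 : 2 ≤ d
      · obtain ⟨c, hcd⟩ : ∃ c, c + 2 = d := ⟨d - 2, by omega⟩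
        have key := sl2_lefschetzPow_lowering_sub θ N Λ hR hcd v t (cs := e') (ds := d + 2 * (t + 1))
          (by omega) rfl he'
        rw [hF hcd, map_zero, hup, map_zero, sub_zero, eq_comm, smul_eq_zero] at key
        exact key.resolve_left (Int.cast_ne_zero.mpr hcoef)
      · have key := sl2_lowering_lefschetzPow_of_le_one θ N Λ hR hR₁ (by omega) v t
          (ds := d + 2 * (t + 1)) rfl he'
        rw [hup, map_zero, eq_comm, smul_eq_zero] at key
        exact key.resolve_left (Int.cast_ne_zero.mpr (neg_ne_zero.mpr hcoef))
  have h0 := hdesc w 0 d (by omega) (by omega)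
  rwa [lefschetzPowTo_zero_apply] at h0

end Formal

/-! ## §4 Hard Lefschetz for the exterior sum; the product polarisation class -/

/-- **Hard Lefschetz for the exterior sum** (Kleiman 1968 Thm. 2.9; André 1996 §1.3): for `X₁`, `X₂`
smooth projective of dimensions `n₁`, `n₂` and `η₁ ∈ H²(X₁(ℂ); ℂ)`, `η₂ ∈ H²(X₂(ℂ); ℂ)` with the hard
Lefschetz property in dimensions `n₁`, `n₂`, the class `θ = fst^* η₁ + snd^* η₂` of `X₁ ⊗ X₂` has the hard
Lefschetz property in dimension `n₁ + n₂`: `Lʲ_θ : Hᵏ → H^{k+2j}` (`k + j = n₁ + n₂`) is injective by the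
`𝔰𝔩₂` argument (`sl2_lefschetzPow_injective` for the triple `(L_θ, Λ₁ ⊗ 1 + 1 ⊗ Λ₂, deg - n₁ - n₂)` of
`exists_sl2Lowering`, `exists_kunnethLowering`, `prod_sl2_lefschetz_lowering_sub`) and the two sides have the
same dimension by Poincaré duality on the `(n₁ + n₂)`-fold `X₁ ⊗ X₂` (`finrank_singularCohomology_eq_of_add_eq`).
[cite: Kleiman1968AlgebraicCycles, Thm. 2.9] [cite: Andre1996Motifs, §1.3 (pp. 12–13)]
[cite: HatcherAT2002, §3.3 Cor. 3.37] -/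
theorem hasHardLefschetzProperty_boxSum (hX₁ : IsSmoothProjective n₁ X₁) (hX₂ : IsSmoothProjective n₂ X₂)
    {η₁ : complexBetti X₁ 2} {η₂ : complexBetti X₂ 2} (hL₁ : HasHardLefschetzProperty η₁ n₁)
    (hL₂ : HasHardLefschetzProperty η₂ n₂) :
    HasHardLefschetzProperty (complexBetti.map (fst X₁ X₂) 2 η₁ + complexBetti.map (snd X₁ X₂) 2 η₂) (n₁ + n₂) := by
  have hP : IsSmoothProjective (n₁ + n₂) (X₁ ⊗ X₂) := IsSmoothProjective.tensor_holds hX₁ hX₂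
  have hv₁ : ∀ m, 2 * n₁ < m → Subsingleton (complexBetti X₁ m) := fun m hm ↦ subsingleton_complexBetti hX₁ hm
  have hv₂ : ∀ m, 2 * n₂ < m → Subsingleton (complexBetti X₂ m) := fun m hm ↦ subsingleton_complexBetti hX₂ hm
  obtain ⟨Λ₁, -, hS₁, hP₁⟩ := exists_sl2Lowering hL₁ hv₁
  obtain ⟨Λ₂, -, hS₂, hP₂⟩ := exists_sl2Lowering hL₂ hv₂
  obtain ⟨Λ, hΛ, hΛl, hΛr, hΛ0⟩ := exists_kunnethLowering hX₁ hX₂ Λ₁ Λ₂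
  set θ := complexBetti.map (fst X₁ X₂) 2 η₁ + complexBetti.map (snd X₁ X₂) 2 η₂ with hθ
  have hR : ∀ {c d e : ℕ} (hcd : c + 2 * 1 = d) (hde : d + 2 * 1 = e) (y : complexBetti (X₁ ⊗ X₂) d),
      lefschetzPowTo θ 1 c d hcd (Λ d c y) - Λ e d (lefschetzPowTo θ 1 d e hde y) =
        ((((d : ℤ) - (n₁ + n₂ : ℕ)) : ℤ) : ℂ) • y := by
    intro c d e hcd hde y
    rw [prod_sl2_lefschetz_lowering_sub hv₁ hv₂ Λ₁ hS₁ hP₁ Λ₂ hS₂ hP₂ Λ hΛ hΛl hΛr hΛ0 hX₁ hX₂ hL₁ hL₂ hcd hde y]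
    congr 1
    push_cast
    ring
  have hR₁ : ∀ {d e : ℕ} (_ : d ≤ 1) (hde : d + 2 * 1 = e) (y : complexBetti (X₁ ⊗ X₂) d),
      Λ e d (lefschetzPowTo θ 1 d e hde y) = (((((n₁ + n₂ : ℕ) : ℤ) - d) : ℤ) : ℂ) • y := by
    intro d e hd hde y
    rw [prod_sl2_lowering_lefschetz_of_le_one hv₁ hv₂ Λ₁ hS₁ Λ₂ hS₂ Λ hΛl hΛr hX₁ hX₂ hd hde y]
    congr 1
  intro j k hkj
  haveI := finite_complexBetti hP k
  haveI := finite_complexBetti hP (k + 2 * j)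
  have hinj : Function.Injective (lefschetzPowTo θ j k (k + 2 * j) rfl) :=
    sl2_lefschetzPow_injective θ (n₁ + n₂) Λ hR hR₁ k hkj rfl
  have hdim : Module.finrank ℂ (complexBetti (X₁ ⊗ X₂) k) = Module.finrank ℂ (complexBetti (X₁ ⊗ X₂) (k + 2 * j)) :=
    ComplexPoints.finrank_singularCohomology_eq_of_add_eq ℂ hP (by omega)
  rw [← lefschetzPowTo_eq_lefschetzPow]
  exact ⟨hinj, (LinearMap.injective_iff_surjective_of_finrank_eq_finrank hdim).mp hinj⟩

/-- **The exterior sum of two polarisation classes is a polarisation class** (André 1996 §1.1 with §1.3: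
"l'isomorphisme de Künneth devient un isomorphisme de `𝔰𝔩₂`-modules si l'on munit `X × Y` du faisceau
inversible ample `𝓛_X ⊠ 𝓛_Y`"): for polarisation classes `η₁`, `η₂` of the smooth projective `X₁`, `X₂`
(dimensions `n₁`, `n₂`), `θ = fst^* η₁ + snd^* η₂` is a polarisation class of the `(n₁ + n₂)`-fold `X₁ ⊗ X₂`:
rational (pull-backs and sums of rational classes), supported on a divisor (flat pull-backs of
divisor-supported classes, `map_fst_mem_supportedClasses`, `map_snd_mem_supportedClasses`), and hard
Lefschetz (`hasHardLefschetzProperty_boxSum`). On the abstract side of the tree this is the axiom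
`PreWeilCohomology.HasProdHyperplaneClasses`; here it is a theorem.
[cite: Andre1996Motifs, §1.1 (p. 10) and §1.3 (pp. 12–13)] [cite: Kleiman1968AlgebraicCycles, Thm. 2.9] -/
theorem isPolarizationClass_boxSum (hX₁ : IsSmoothProjective n₁ X₁) (hX₂ : IsSmoothProjective n₂ X₂)
    {η₁ : complexBetti X₁ 2} {η₂ : complexBetti X₂ 2} (hη₁ : IsPolarizationClass n₁ X₁ η₁)
    (hη₂ : IsPolarizationClass n₂ X₂ η₂) :
    IsPolarizationClass (n₁ + n₂) (X₁ ⊗ X₂)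
      (complexBetti.map (fst X₁ X₂) 2 η₁ + complexBetti.map (snd X₁ X₂) 2 η₂) where
  isRationalClass :=
    (hη₁.isRationalClass.map (AlgPoints.mapContinuous (L := ℂ) (fst X₁ X₂))).add
      (hη₂.isRationalClass.map (AlgPoints.mapContinuous (L := ℂ) (snd X₁ X₂)))
  mem_algebraicClasses :=
    Submodule.add_mem _ (map_fst_mem_supportedClasses hX₁ hX₂ hη₁.mem_algebraicClasses)
      (map_snd_mem_supportedClasses hX₁ hX₂ hη₂.mem_algebraicClasses)
  hasHardLefschetz := hasHardLefschetzProperty_boxSum hX₁ hX₂ hη₁.hasHardLefschetz hη₂.hasHardLefschetz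

end Summit.HodgeConjecture.HodgeConjecture.Theorems

end
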